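import Literature.AlgebraicGeometry.Resolution.PointBlowupFlagTranslatedStep

/-!
# Hauser–Perlega §4 in fixed coordinates, II: terminal readings (`d_res = 0` is the monomial case; the small
# residual case at `a′`) and [HP24, Prop. 4], case (ii) (`n_G = 0`, `t ≠ 0`, both components lost)

H. Hauser, S. Perlega, *Resolving surface singularities in positive characteristic*, Publ. RIMS Kyoto Univ. **60**
(2024) 767–813 [cite: HauserPerlega2024].  Proof of Prop. 4, case (ii), p. 795: "Set `y₀ = y − tx ∈ 𝒪̂_{W,a}`. Let
`z₀ = z + g₀(x, y)` be the change of parameters which eliminates all `pᵉ`th powers from the expansion of `F` with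
respect to `x, y₀`. Let `𝓕` be the flag at `a` given by `𝓕₂ = V(z₀)`, `𝓕₁ = V(z₀, y₀)`. Since `E_a = V(xy)`, we know that
`n_𝓕 = 1`. As argued in Section 4, the flag `𝓕` fulfills the inequality `d_𝓖 = d′_res ≤ d^curv_𝓕`. If `d_𝓕 = d^curv_𝓕`,
this already proves that `inv^𝓖_{a′}(X′) < inv^𝓕_a(X)` since `n_𝓖 < n_𝓕`. Now assume that `d_𝓕 = 0` instead. By
definition and since `n_𝓕 ≥ 1`, this holds if `0 < d^curv_𝓕 < pᵉ` and `ord_ω(F) = k pᵉ` for some positive integer `k`.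
As `ord(F) = ord_ω(F)`, this implies that also `ord F = k pᵉ`. Consequently, `F′(x, y) = x^{(k−1)pᵉ}·G′(x, y)`, where
`ord G′ = d′_res ≤ d^curv_𝓕 < pᵉ`. We cannot have `ord G′ = 0` since then a `pᵉ`th power would appear in the
expansion. Thus `ord G′ > 0`. But this gives that `X′` is in the small residual case at `a′`. Since we assumed that
`X′` is not in a terminal case at `a′`, both of these possibilities contradict our assumption."  §4 p. 777:
"Clearly, `X` is in the classical monomial case at `a` if and only if `d_res = 0` holds."

In the atlas model (`PointBlowupFlagInvariant`: `dRes`, `IsTerminalSub`, `invCaseN0`, `invCaseTangent`; two letters,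
chart letter `x`), on top of the dictionary `PointBlowupFlagTranslatedStep`:

* §4 `isTerminalSub_of_dRes_eq_zero` — for a clean non-zero `F` and a non-empty set of exceptional letters, `d_res = 0`
  is the monomial case (the exceptional monomial IS a monomial of `F`); `isTerminalSub_of_dRes_lt` — `ord_x G = kq`,
  `k ≥ 1`, `0 < d_res({x}) < q` is the small residual case `G = x^{kq}·g`, `0 < ord g < q`; both witnessed on the axis
  flag `⟨y, x, 0⟩` (`isCaseN0_axisFlag`, `expansion_axisFlag`); the tangent flag `Φ_t = ⟨y, x, −t·X⟩` is of case (ii)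
  with `n = 1` when both letters are exceptional (`isCaseTangent_shearFlag`).
* §5 `exists_dt_shearFlag` — THE SITUATION AT A POINT OF THE `x`-CHART over a clean `F` of order `o > q` when `X′` is
  not in a terminal case at `a′` (any field, any `q`, any `t`): a least-degree monomial `x^{o−j} y^j` of `F₀ = F_t` with
  `j = d_t ≥ 1`, `d_{Φ_t} = d_t` (the clause `d_𝓕 = 0` is excluded: it would force a terminal case at `a′`) and
  `d′_res ≤ d_res({x}) ≤ d_t`; and `invCaseN0_step_lt_invCaseTangent_shearFlag` — **[HP24, Prop. 4] case (ii)**: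
  for EVERY flag `G` of case (i) at `a′`, `inv_G = (d′_res, 0, s_G) < (d_{Φ_t}, 1, 0) = inv_{Φ_t}` (the hypotheses
  `t ≠ 0` and "both letters exceptional at `a`" of the printed case are only needed to make `Φ_t` an ADAPTED flag of
  case (ii), `isCaseTangent_shearFlag`; the inequality holds without them).  With the maximising flag `G` at `a′` of
  case (i) this is the case-(ii) clause of `FlagInvariantDropsStatement`.

Case (iv) of Prop. 4 is the sequel `PointBlowupFlagKangarooCase`.  Nothing beyond the quoted lines is claimed.
-/

noncomputable section

open MvPolynomial Finset
open scoped BigOperators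

namespace Literature.AlgebraicGeometry.Resolution

open Literature.AlgebraicGeometry.Resolution.Hauser2010
open Literature.AlgebraicGeometry.Resolution.PointBlowup
open Literature.AlgebraicGeometry.Resolution.HauserWagner2014
open Literature.AlgebraicGeometry.Resolution.WeightedBlowup
open Literature.Barriers.ResolutionOfSingularities

namespace HauserPerlega2024

/-! ## 4. Flags used at `a` and `a′`; terminal readings -/

section Terminal

variable {σ : Type*} {K : Type*} [Field K] [DecidableEq σ]

/-- The weights of a flag with `n = 1` are all `1`. [cite: HauserPerlega2024, §5 p. 784 (ω(x₁) = 1, ω(y₁) = n)] -/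
theorem FlagDatum.weights_one (Φ : FlagDatum σ K) : Φ.weights 1 = fun _ => 1 := by
  funext i
  unfold FlagDatum.weights
  split_ifs <;> rfl

omit [DecidableEq σ] in
/-- The tangent flag `Φ_t = ⟨y, x, −t·X⟩` (`F₁ = V(z_t, y + t x)`) through both exceptional components is a flag of
case (ii) with `n = 1`. [cite: HauserPerlega2024, §6 p. 795 (Since E_a = V(xy), we know that n_F = 1)] -/
theorem isCaseTangent_shearFlag {x y : σ} (hxy : x ≠ y) {E : Finset σ} (hx : x ∈ E) (hy : y ∈ E) {t : K}
    (ht : t ≠ 0) : (⟨y, x, (-t) • PowerSeries.X⟩ : FlagDatum σ K).IsCaseTangent E 1 := by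
  refine ⟨⟨Ne.symm hxy, ?_⟩, hy, ?_, Or.inr ⟨rfl, hx⟩⟩
  · show PowerSeries.constantCoeff ((-t) • (PowerSeries.X : PowerSeries K)) = 0
    rw [PowerSeries.smul_eq_C_mul, map_mul, PowerSeries.constantCoeff_X, mul_zero]
  · show ((-t) • (PowerSeries.X : PowerSeries K)).order = 1
    have h : ((-t) • (PowerSeries.X : PowerSeries K)).order = ((1 : ℕ) : ℕ∞) := by
      rw [PowerSeries.order_eq_nat]
      refine ⟨?_, fun i hi => ?_⟩
      · rw [map_smul, PowerSeries.coeff_one_X, smul_eq_mul, mul_one]; exact neg_ne_zero.mpr ht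
      · obtain rfl : i = 0 := by omega
        rw [map_smul, PowerSeries.coeff_zero_X, smul_zero]
    exact h

omit [DecidableEq σ] in
/-- The axis flag `⟨y, x, 0⟩` (`F₁ = V(z, y)`) is a flag of case (i) for every set of exceptional letters.
[cite: HauserPerlega2024, §5 p. 783 (i) (F₁ equals a component / transversal flag)] -/
theorem isCaseN0_axisFlag {x y : σ} (hxy : x ≠ y) (E : Finset σ) :
    (⟨y, x, 0⟩ : FlagDatum σ K).IsCaseN0 E :=
  ⟨⟨Ne.symm hxy, map_zero _⟩, fun _ => rfl⟩

/-- The expansion of the axis flag is the clean polynomial itself. [cite: HauserPerlega2024, §5 p. 783 (clean expansion in subordinate parameters)] -/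
theorem expansion_axisFlag (x y : σ) (q : ℕ) (F : MvPolynomial σ K) :
    FlagDatum.expansion ⟨y, x, 0⟩ q F = ((deletePthPowers q F : MvPolynomial σ K) : MvPowerSeries σ K) := by
  classical
  change cleanSeries q (substFree x y (-0) F) = _
  rw [neg_zero, ← zero_smul K (PowerSeries.X : PowerSeries K), substFree_smul_X_eq_coe x y, cleanSeries_coe]
  have hfun : (fun l => if l = y then (X y + C (0 : K) * X x : MvPolynomial σ K) else X l) = X := by
    funext l
    split_ifs with h
    · rw [h, map_zero, zero_mul, add_zero]
    · rfl
  rw [hfun, MvPolynomial.aeval_X_left_apply]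

/-- The exponent of the exceptional monomial, letterwise. [cite: HauserPerlega2024, §4 p. 776 (M the unique monomial of maximal degree supported on E_a dividing F)] -/
theorem excExponent_apply (E : Finset σ) (F : MvPolynomial σ K) (l : σ) :
    excExponent E F l = if l ∈ E then ordVar F l else 0 := by
  unfold excExponent
  rw [Finsupp.finsetSum_apply]
  simp_rw [Finsupp.single_apply]
  rw [Finset.sum_ite_eq' E l]

/-- The exceptional monomial divides every monomial. [cite: HauserPerlega2024, §4 p. 776 (F = M·G)] -/
theorem excExponent_le_of_mem_support (E : Finset σ) {F : MvPolynomial σ K} {d : σ →₀ ℕ} (hd : d ∈ F.support) :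
    excExponent E F ≤ d := by
  rw [Finsupp.le_def]
  intro l
  rw [excExponent_apply]
  split_ifs
  · exact ordVar_le_of_mem_support hd l
  · exact Nat.zero_le _

omit [DecidableEq σ] in
/-- The degree of the exceptional monomial is the sum of the orders along the exceptional letters.
[cite: HauserPerlega2024, §4 p. 776 (ord_{E_a} F)] -/
theorem degree_excExponent (E : Finset σ) (F : MvPolynomial σ K) :
    (excExponent E F).degree = ∑ i ∈ E, ordVar F i := by
  unfold excExponent
  rw [map_sum]
  exact Finset.sum_congr rfl fun i _ => Finsupp.degree_single _ _

omit [DecidableEq σ] in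
/-- Division by a monomial dividing every monomial: `P = x^m · (P / x^m)` as power series.
[cite: HauserPerlega2024, §4 p. 776 (F = M·G)] -/
theorem coe_eq_monomial_mul_divMonomial {P : MvPolynomial σ K} {m : σ →₀ ℕ} (hm : ∀ d ∈ P.support, m ≤ d) :
    (P : MvPowerSeries σ K) = MvPowerSeries.monomial m 1 * divMonomial m (P : MvPowerSeries σ K) := by
  ext d
  rw [MvPowerSeries.coeff_monomial_mul]
  split_ifs with h
  · rw [one_mul]
    show MvPowerSeries.coeff d (P : MvPowerSeries σ K) = (P : MvPowerSeries σ K) (d - m + m)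
    rw [tsub_add_cancel_of_le h]
    rfl
  · rw [MvPolynomial.coeff_coe]
    by_contra hne
    exact h (hm d (MvPolynomial.mem_support_iff.mpr hne))

variable [Fintype σ]

/-- The order of the quotient by a monomial dividing every monomial: `ord (P / x^m) = ord P − |m|`.
[cite: HauserPerlega2024, §4 p. 776 (d_res = ord G = ord F − ord_{E_a} F)] -/
theorem order_divMonomial_coe {x y : σ} (hxy : x ≠ y) (hσ : ∀ l, l = x ∨ l = y) {P : MvPolynomial σ K}
    {m : σ →₀ ℕ} (hm : ∀ d ∈ P.support, m ≤ d) {o : ℕ} (ho : ordZero P = o) :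
    (divMonomial m (P : MvPowerSeries σ K)).order = ((o - m.degree : ℕ) : ℕ∞) := by
  obtain ⟨⟨d₀, hd₀, hd₀deg⟩, hmin⟩ := exists_mem_support_degree_eq ho
  have happ : ∀ d, MvPowerSeries.coeff d (divMonomial m (P : MvPowerSeries σ K)) = coeff (d + m) P := fun d => by
    show MvPowerSeries.coeff (d + m) (P : MvPowerSeries σ K) = _
    exact MvPolynomial.coeff_coe _ _
  rw [MvPowerSeries.order_eq_nat]
  refine ⟨⟨d₀ - m, ?_, ?_⟩, fun d hd => ?_⟩
  · rw [happ, tsub_add_cancel_of_le (hm d₀ hd₀)]; exact MvPolynomial.mem_support_iff.mp hd₀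
  · have h1 := Finsupp.le_def.mp (hm d₀ hd₀)
    have hx' := h1 x
    have hy' := h1 y
    rw [degree_eq_two hxy hσ, degree_eq_two hxy hσ, Finsupp.tsub_apply, Finsupp.tsub_apply]
    rw [degree_eq_two hxy hσ] at hd₀deg
    omega
  · rw [happ]
    by_contra hne
    have h2 := hmin (d + m) (MvPolynomial.mem_support_iff.mpr hne)
    rw [map_add] at h2
    have h3 : d.degree < o - m.degree := by exact_mod_cast hd
    omega

/-- **`d_res = 0` is the monomial case** (for a clean non-zero `F` with at least one exceptional letter): the exceptional
monomial `M` is itself a monomial of `F`, so `F = M·u`, `u` a unit, `M` not a `q`-th power; hence `X` is in a terminal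
case (witnessed on the axis flag `⟨y, x, 0⟩`). [cite: HauserPerlega2024, §4 p. 777 (X is in the classical monomial case at a iff d_res = 0), §3 p. 775 (monomial case)] -/
theorem isTerminalSub_of_dRes_eq_zero {x y : σ} (hxy : x ≠ y) (hσ : ∀ l, l = x ∨ l = y) (q : ℕ) {E : Finset σ}
    (hE : E.Nonempty) {F : MvPolynomial σ K} (hF : F ≠ 0) (hclean : deletePthPowers q F = F)
    (h0 : dRes E F = 0) : IsTerminalSub q E F := by
  refine ⟨⟨y, x, 0⟩, isCaseN0_axisFlag hxy E, Or.inl ?_⟩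
  rw [expansion_axisFlag, hclean]
  set m := excExponent E F with hm
  obtain ⟨o, ho'⟩ := WithTop.ne_top_iff_exists.mp (show ordZero F ≠ ⊤ by
    unfold ordZero; rw [Ne, MvPowerSeries.order_eq_top_iff, MvPolynomial.coe_eq_zero_iff]; exact hF)
  have ho : ordZero F = o := ho'.symm
  obtain ⟨⟨d₀, hd₀, hd₀deg⟩, -⟩ := exists_mem_support_degree_eq ho
  have hmle : ∀ d ∈ F.support, m ≤ d := fun d hd => excExponent_le_of_mem_support E hd
  -- `d_res = 0`: the least-degree monomial `d₀` IS the exceptional monomial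
  have hdeg0 : o ≤ m.degree := by
    unfold dRes at h0
    rw [ho, ENat.toNat_coe, ← degree_excExponent, ← hm] at h0
    have := hd₀deg ▸ (show m.degree ≤ d₀.degree from by
      have h1 := Finsupp.le_def.mp (hmle d₀ hd₀)
      rw [degree_eq_two hxy hσ, degree_eq_two hxy hσ]; have := h1 x; have := h1 y; omega)
    omega
  have hmd₀ : m = d₀ := by
    have h1 := Finsupp.le_def.mp (hmle d₀ hd₀)
    have hx' := h1 x
    have hy' := h1 y
    rw [degree_eq_two hxy hσ] at hd₀deg hdeg0
    rw [finsupp_eq_single_add_single hxy hσ m, finsupp_eq_single_add_single hxy hσ d₀]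
    congr 1 <;> congr 1 <;> omega
  refine ⟨m, divMonomial m (F : MvPowerSeries σ K), coe_eq_monomial_mul_divMonomial hmle, ?_, ?_,
    fun h => absurd h hE.ne_empty⟩
  · rw [← MvPowerSeries.coeff_zero_eq_constantCoeff_apply]
    show MvPowerSeries.coeff (0 + m) (F : MvPowerSeries σ K) ≠ 0
    rw [zero_add, MvPolynomial.coeff_coe, hmd₀]
    exact MvPolynomial.mem_support_iff.mp hd₀
  · rw [← isPthPowerExponent_iff, hmd₀]
    exact not_isPthPowerExponent_of_clean q hclean hd₀

/-- **The small residual case at `a′`** ([HP24, Prop. 4 (ii)]): if the residual polynomial `G` (clean, non-zero) has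
`ord_x G = k·q` with `k ≥ 1` and `0 < d_res({x}) < q`, then `G = x^{kq}·g` with `0 < ord g < q` — a terminal case
(witnessed on the axis flag). [cite: HauserPerlega2024, §6 p. 795 (case (ii): F′ = x^{(k−1)pᵉ}·G′, 0 < ord G′ < pᵉ, small residual case), §3 p. 775 (small residual case)] -/
theorem isTerminalSub_of_dRes_lt {x y : σ} (hxy : x ≠ y) (hσ : ∀ l, l = x ∨ l = y) (q : ℕ) (E : Finset σ)
    {G : MvPolynomial σ K} (hG : G ≠ 0) (hclean : deletePthPowers q G = G) {k : ℕ} (hk : 0 < k)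
    (hordx : ordVar G x = k * q) (hpos : 0 < dRes {x} G) (hlt : dRes {x} G < q) : IsTerminalSub q E G := by
  refine ⟨⟨y, x, 0⟩, isCaseN0_axisFlag hxy E, Or.inr ⟨x, k, divMonomial (Finsupp.single x (k * q))
    (G : MvPowerSeries σ K), hk, ?_, ?_⟩⟩
  · rw [expansion_axisFlag, hclean, MvPowerSeries.X_pow_eq]
    exact coe_eq_monomial_mul_divMonomial fun d hd => Finsupp.single_le_iff.mpr (hordx ▸ ordVar_le_of_mem_support hd x)
  · obtain ⟨o, ho'⟩ := WithTop.ne_top_iff_exists.mp (show ordZero G ≠ ⊤ by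
      unfold ordZero; rw [Ne, MvPowerSeries.order_eq_top_iff, MvPolynomial.coe_eq_zero_iff]; exact hG)
    have ho : ordZero G = o := ho'.symm
    have hord := order_divMonomial_coe hxy hσ
      (fun d hd => Finsupp.single_le_iff.mpr (hordx ▸ ordVar_le_of_mem_support hd x)) ho
    rw [Finsupp.degree_single] at hord
    rw [dRes_singleton, ho, ENat.toNat_coe, hordx] at hpos hlt
    rw [hord]
    exact ⟨by exact_mod_cast hpos, by exact_mod_cast hlt⟩

end Terminal

/-! ## 5. [HP24, Prop. 4], case (ii): `n_G = 0`, `t ≠ 0`, both components lost -/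

section CaseTwo

variable {σ : Type*} {K : Type*} [Field K] [Fintype σ] [DecidableEq σ] [DecidableEq K]

omit [DecidableEq K] in
/-- `ord F` is the least degree `w₀^{(1)}` of the package bookkeeping. [cite: HauserPerlega2024, §4 p. 781 (ω(g) = min{i + jn})] -/
theorem ordZero_eq_minPkgWeight_one (q : ℕ) (j : σ) {F : MvPolynomial σ K} (hF : F ≠ 0) :
    ordZero F = minPkgWeight j 1 F := by
  have h := ordZero_pkgTransform (q := q) (j := j) (m := 0) hF (fun d _ => by rw [zero_mul]; exact Nat.zero_le _)
  rwa [pkgTransform_zero, zero_mul, Nat.sub_zero] at h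

omit [Fintype σ] in
/-- The new exceptional component `{x = 0}` passes through the point of the `x`-chart (for `ord F > q`).
[cite: HauserPerlega2024, §4 p. 779 (E′_{a′} = V(xy) or V(x))] -/
theorem mem_excLetters_step_self (q : ℕ) {x : σ} {b : σ → K} (hbx : b x = 0) (s : State σ K)
    (hord : (q : ℕ∞) < ordZero s.F) (hF : s.F ≠ 0) : x ∈ excLetters (step q x b s) := by
  obtain ⟨o, ho'⟩ := WithTop.ne_top_iff_exists.mp (show ordZero s.F ≠ ⊤ by
    unfold ordZero; rw [Ne, MvPowerSeries.order_eq_top_iff, MvPolynomial.coe_eq_zero_iff]; exact hF)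
  have ho : ordZero s.F = o := ho'.symm
  have hqo : q < o := by rw [ho] at hord; exact_mod_cast hord
  unfold excLetters
  change x ∈ (newMult q x b s).support
  rw [newMult_eq q x b hbx s ho, Finsupp.mem_support_iff, Finsupp.filter_apply, if_pos hbx,
    Finsupp.update_apply, if_pos rfl]
  omega

/-- **The situation at a point** `b = (0, t)` of the `x`-chart (`t = 0` allowed) above a clean `F` of order
`o > q`, when `X′` is NOT in a terminal case at `a′` (any field, any `q`): there is a least-degree monomial `x^{o−j} y^j`
of the clean sheared expansion `F₀ = F_t` with `j = d_t = ord_{(y_t)} in(F_t)` (least `y`-exponent in degree `o`) such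
that `d_{Φ_t} = d_t = j ≥ 1` for the tangent flag `Φ_t = ⟨y, x, −t·X⟩` (the clause "`d_𝓕 = 0`" and `d_t = 0` would both
put `X′` in a terminal case at `a′`) and `d′_res ≤ d_res({x}) ≤ j` (Figure 1).
[cite: HauserPerlega2024, §4 pp. 779–780 (d′_res ≤ d_t), §6 p. 795 (case (ii): d_𝓕 = 0 forces the small residual case at a′)] -/
theorem exists_dt_shearFlag {x y : σ} (hxy : x ≠ y) (hσ : ∀ l, l = x ∨ l = y) (q : ℕ) (s : State σ K) (b : σ → K)
    (hbx : b x = 0) (hF : s.F ≠ 0) (hclean : deletePthPowers q s.F = s.F) {o : ℕ}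
    (ho : ordZero s.F = o) (hqo : q < o)
    (hnt : ¬ IsTerminalSub q (excLetters (step q x b s)) (step q x b s).F) :
    ∃ d₀ ∈ (deletePthPowers q (MvPolynomial.aeval
        (fun l => if l = y then (X y + C (b y) * X x : MvPolynomial σ K) else X l) s.F)).support,
      d₀.degree = o ∧
      (∀ d ∈ (deletePthPowers q (MvPolynomial.aeval
        (fun l => if l = y then (X y + C (b y) * X x : MvPolynomial σ K) else X l) s.F)).support,
        d.degree = o → d₀ y ≤ d y) ∧
      dFlag q ⟨y, x, (-(b y)) • PowerSeries.X⟩ 1 s.F = d₀ y ∧ 0 < d₀ y ∧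
      dRes {x} (step q x b s).F ≤ d₀ y ∧
      dRes (excLetters (step q x b s)) (step q x b s).F ≤ dRes {x} (step q x b s).F := by
  set t := b y with ht
  set s' := step q x b s with hs'
  set E' := excLetters s' with hE'
  set F₀ : MvPolynomial σ K := deletePthPowers q
    (MvPolynomial.aeval (fun l => if l = y then (X y + C t * X x : MvPolynomial σ K) else X l) s.F) with hF₀
  -- the dictionary
  have hstep : s'.F = chartTransform q x F₀ :=
    step_F_eq_chartTransform_clean_shear hxy hσ q b hbx s (by rw [ho]; exact_mod_cast hqo.le)
  have hexp : FlagDatum.expansion ⟨y, x, (-t) • PowerSeries.X⟩ q s.F = (F₀ : MvPowerSeries σ K) :=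
    expansion_shearFlag_eq_coe x y q t s.F
  have hoF₀ : ordZero F₀ = o := by rw [hF₀, ordZero_cleanShear_eq hxy hσ q t hF hclean, ho]
  have hF₀ne : F₀ ≠ 0 := by
    intro h0
    rw [h0, ordZero_zero] at hoF₀
    exact WithTop.top_ne_natCast o hoF₀
  obtain ⟨⟨-, -⟩, hmin₀⟩ := exists_mem_support_degree_eq hoF₀
  have hsuppq : ∀ d ∈ F₀.support, q ≤ d.degree := fun d hd => hqo.le.trans (hmin₀ d hd)
  -- `d_t`, attained at a least-degree monomial `d₀` of `F₀`
  obtain ⟨⟨d₀, hd₀, hd₀deg, hd₀y⟩, hd₀min⟩ := exists_mem_support_apply_eq_ordAlong_initialPart y hoF₀ (K := K)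
  have hdCurv : dCurv q ⟨y, x, (-t) • PowerSeries.X⟩ 1 s.F = ((d₀ y : ℕ) : ℕ∞) := by
    unfold dCurv
    rw [FlagDatum.weights_one, hexp, ← hd₀y]
  -- Figure 1: `d′_res ≤ d_t`
  have hs'ne : s'.F ≠ 0 := by rw [hstep]; exact chartTransform_ne_zero q x hF₀ne hsuppq
  have hs'clean : deletePthPowers q s'.F = s'.F := deletePthPowers_step q x b s
  have hxE' : x ∈ E' := mem_excLetters_step_self q hbx s (by rw [ho]; exact_mod_cast hqo) hF
  have hres_x : dRes {x} s'.F ≤ d₀ y := by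
    rw [hstep]; exact dRes_chartTransform_le hxy hσ q hoF₀ hqo.le hd₀ hd₀deg
  have hres : dRes E' s'.F ≤ dRes {x} s'.F := dRes_mono (Finset.singleton_subset_iff.mpr hxE') _
  have hordx : ordVar s'.F x = o - q := by rw [hstep]; exact ordVar_chartTransform_self hxy hσ q hF₀ne hoF₀ hqo.le
  -- `d_t = 0` and the clause `d_{Φ_t} = 0` are excluded by non-terminality at `a′`
  have hpos : 0 < d₀ y := by
    by_contra h0
    apply hnt
    exact isTerminalSub_of_dRes_eq_zero hxy hσ q ⟨x, hxE'⟩ hs'ne hs'clean (by omega)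
  have hnotClause : ¬ (0 < d₀ y ∧ d₀ y < q ∧ q ∣ o) := by
    rintro ⟨-, hlt, hdvd⟩
    apply hnt
    rcases Nat.eq_zero_or_pos (dRes {x} s'.F) with h0 | hpos'
    · exact isTerminalSub_of_dRes_eq_zero hxy hσ q ⟨x, hxE'⟩ hs'ne hs'clean
        (Nat.le_zero.mp (h0 ▸ hres))
    · obtain ⟨j, hj⟩ := hdvd
      have hj2 : 2 ≤ j := by
        by_contra hj1
        interval_cases j <;> simp_all
      refine isTerminalSub_of_dRes_lt hxy hσ q E' hs'ne hs'clean (k := j - 1) (by omega) ?_ hpos'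
        (lt_of_le_of_lt hres_x hlt)
      rw [hordx, hj, Nat.sub_mul, one_mul, mul_comm]
  have hdFlag : dFlag q ⟨y, x, (-t) • PowerSeries.X⟩ 1 s.F = d₀ y := by
    unfold dFlag
    dsimp only
    rw [hdCurv, ENat.toNat_coe, FlagDatum.weights_one, hexp, show wOrder (fun _ => (1 : ℕ))
      (F₀ : MvPowerSeries σ K) = ordZero F₀ from rfl, hoF₀, ENat.toNat_coe, if_neg hnotClause]
  exact ⟨d₀, hd₀, hd₀deg, fun d hd hdeg => by exact_mod_cast (hd₀y ▸ hd₀min d hd hdeg), hdFlag, hpos, hres_x, hres⟩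

/-- **[HP24, Prop. 4], case (ii)** ("`n_G = 0`, `t ≠ 0`, and `E_a = V(xy)`") in the atlas model, for any field and any
`q`: at a point `b = (0, t)` of the `x`-chart above a clean `F` of order `> q` (`t = 0` allowed, but the printed
case is `t ≠ 0`), if `X′` is not in a terminal case at `a′`, then for EVERY flag `G` of case (i) at `a′` the flag invariant `(d′_res, 0, s_G)` is lexicographically below
the invariant `(d_{Φ_t}, 1, 0)` of the tangent flag `Φ_t = ⟨y, x, −t·X⟩` at `a` (`F₁ = V(z_t, y + t x)`; `n_{Φ_t} = 1`
and `Φ_t` is ADAPTED when both letters are exceptional, `isCaseTangent_shearFlag`).  Printed proof: `d_G = d′_res ≤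
d^curv_{Φ_t}` (Figure 1); if `d_{Φ_t} = d^curv_{Φ_t}` this suffices since `n_G = 0 < 1 = n_{Φ_t}`; otherwise
`d_{Φ_t} = 0`, `0 < d^curv < pᵉ`, `pᵉ ∣ ord F`, and then `X′` is in the small residual (or monomial) case at `a′` —
excluded. [cite: HauserPerlega2024, Prop. 4 p. 793, proof of case (ii) p. 795] -/
theorem invCaseN0_step_lt_invCaseTangent_shearFlag {x y : σ} (hxy : x ≠ y) (hσ : ∀ l, l = x ∨ l = y) (q : ℕ)
    (s : State σ K) (b : σ → K) (hbx : b x = 0) (hF : s.F ≠ 0)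
    (hclean : deletePthPowers q s.F = s.F) (hord : (q : ℕ∞) < ordZero s.F)
    (hnt : ¬ IsTerminalSub q (excLetters (step q x b s)) (step q x b s).F) (G : FlagDatum σ K) :
    invCaseN0 q (excLetters (step q x b s)) G (step q x b s).F <
      invCaseTangent q ⟨y, x, (-(b y)) • PowerSeries.X⟩ 1 s.F := by
  obtain ⟨o, ho'⟩ := WithTop.ne_top_iff_exists.mp (show ordZero s.F ≠ ⊤ by
    unfold ordZero; rw [Ne, MvPowerSeries.order_eq_top_iff, MvPolynomial.coe_eq_zero_iff]; exact hF)
  have ho : ordZero s.F = o := ho'.symm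
  have hqo : q < o := by rw [ho] at hord; exact_mod_cast hord
  obtain ⟨d₀, -, -, -, hdFlag, -, hres_x, hres⟩ := exists_dt_shearFlag hxy hσ q s b hbx hF hclean ho hqo hnt
  unfold invCaseN0 invCaseTangent
  rw [hdFlag, Prod.Lex.toLex_lt_toLex]
  rcases (hres.trans hres_x).lt_or_eq with hlt | heq
  · exact Or.inl hlt
  · exact Or.inr ⟨heq, Prod.Lex.toLex_lt_toLex.mpr (Or.inl zero_lt_one)⟩

end CaseTwo

end HauserPerlega2024

end Literature.AlgebraicGeometry.Resolution

end
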